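import Literature.AnabelianGeometry.SemiGraphs.ProfiniteSemiGraphIsoTransportAtBodies
import Literature.AnabelianGeometry.SemiGraphs.SgATemperedArrows
import HarnessLib

/-!
# Tempered arrows of `SgA` inherit the bodies of [SemiAnbd] Thm 3.7 AT the profinite presentation of
# their source (route T, TRANSPORT VII — corollary for the R1 bridge)

Mochizuki, *Semi-graphs of anabelioids*, Publ. RIMS **42** (2006), Def. 3.5 (ii) p. 37 (tempered
coverings) and Thm. 3.7 (iii)–(iv) pp. 40–41 [cite: MochizukiSemiAnbd2006, Thm 3.7(iii)(iv) pp.40-41].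

abc-iut-L3-t3's `SgAQuot.SgA.IsTemperedCoveringOf f` (`SgATemperedArrows.lean`) says: read on profinite
presentations, the arrow `f : H ⟶ G` of `SgA` is isomorphic OVER `G.toSgA.toProfinite` to the covering
`G_S → G` of a tempered object `S` of `B^cov`.  Route T puts the four bodies of Thm 3.7 AT `G_S`
(`CovObj.compactInVerticialAt_coveringGraph'` & co., abc-iut-L3-d6) and TRANSPORT VII moves them along
the isomorphism (`thm37At_of_isoOver_coveringHom`); this file records the composite at the level of the
ambient category: for a tempered arrow `f` over a coherent Thm-3.7 base at which Thm 3.7 (iii) holds —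
e.g. a FINITE coherent Thm-3.7 base — Thm 3.7 (iii), (iv) and the edge-like corollaries hold AT the
profinite presentation `H.toSgA.toProfinite` of the source.  Proof-only (abc-iut cell, L3 route T; seat
abc-iut-L3-d6); nothing here bears on [IUTchIII] Cor. 3.12.
-/

namespace Literature.AnabelianGeometry.SemiGraphs

namespace SgAQuot.SgA

open SemiGraphOfAnabelioids ProfiniteSemiGraph

universe u

variable {H G : SgA.{u, u, u}} {f : H ⟶ G}

/-- **A tempered arrow `f : H ⟶ G` of `SgA` over a coherent Thm-3.7 base at which Thm 3.7 (iii) holds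
carries the four bodies of Thm 3.7 AT the profinite presentation of its source.**
[cite: MochizukiSemiAnbd2006, Thm 3.7(iii)(iv) pp.40-41] -/
theorem IsTemperedCoveringOf.thm37At (hf : IsTemperedCoveringOf f)
    (h37 : G.toSgA.toProfinite.Thm37Hypotheses) (hcoh : G.toSgA.toProfinite.IsCoherent)
    (hiii : CompactInVerticialAt G.toSgA.toProfinite) :
    CompactInVerticialAt H.toSgA.toProfinite ∧ MaximalCompactIffVerticialAt H.toSgA.toProfinite ∧
      EdgeLikeIsInfVerticialAt H.toSgA.toProfinite ∧ EdgeLikeDistinctAt H.toSgA.toProfinite := by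
  obtain ⟨S, hS, ⟨I⟩⟩ := hf
  exact thm37At_of_isoOver_coveringHom S I h37 hcoh hiii hS

/-- The same over a FINITE coherent Thm-3.7 base (Thm 3.7 (iii) at finite graphs,
`compactInVerticialAt_of_finiteGraph`). [cite: MochizukiSemiAnbd2006, Thm 3.7(iii)(iv) pp.40-41] -/
theorem IsTemperedCoveringOf.thm37At_of_finite [Finite G.toSgA.toProfinite.graph.Vertex]
    [Finite G.toSgA.toProfinite.graph.Edge] (hf : IsTemperedCoveringOf f)
    (h37 : G.toSgA.toProfinite.Thm37Hypotheses) (hcoh : G.toSgA.toProfinite.IsCoherent) :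
    CompactInVerticialAt H.toSgA.toProfinite ∧ MaximalCompactIffVerticialAt H.toSgA.toProfinite ∧
      EdgeLikeIsInfVerticialAt H.toSgA.toProfinite ∧ EdgeLikeDistinctAt H.toSgA.toProfinite :=
  hf.thm37At h37 hcoh compactInVerticialAt_of_finiteGraph

/-- **The hypotheses of Thm 3.7 at the source of a tempered arrow**: they hold at `H.toSgA.toProfinite`
as soon as they hold at the covering graph `G_S` of the witnessing tempered object (route T supplies the
latter for connected `S` over a strictly coherent Thm-3.7 base, `CovObj.thm37Hypotheses_coveringGraph`).
[cite: MochizukiSemiAnbd2006, Thm 3.7 p.40] -/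
theorem IsTemperedCoveringOf.exists_thm37Hypotheses_iff (hf : IsTemperedCoveringOf f) :
    ∃ S : CovObj G.toSgA.toProfinite, S.IsTempered ∧
      Nonempty (Hom.IsoOver (repHomOver f).toProfinite S.coveringHom) ∧
      (H.toSgA.toProfinite.Thm37Hypotheses ↔ S.coveringGraph.Thm37Hypotheses) := by
  obtain ⟨S, hS, ⟨I⟩⟩ := hf
  exact ⟨S, hS, ⟨I⟩, I.thm37Hypotheses_iff⟩

end SgAQuot.SgA

end Literature.AnabelianGeometry.SemiGraphs
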